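import Mathlib
import Summits.Ventures.DiscreteObjects.Mahler.OddCoefficientsResultant
import Summits.Ventures.DiscreteObjects.Mahler.SubLehmerDegree56

/-!
# Polynomials with all coefficients `≡ 1 (mod m)`: `M(f)^{d+1} ≥ (m/2)^d` (venture `DiscreteObjects`, target L)

Cell `pub-namedobj`, seat `pub-namedobj-mahler` (gen 8). Framing: lottery ticket; floor = certified
bounds/negative ranges.

Borwein–Dobrowolski–Mossinghoff, *Lehmer's problem for polynomials with odd coefficients*, Ann. of Math.
166 (2007), the class `D_m` (all coefficients `≡ 1 mod m`), general `m`: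

* `exists_X_pow_sub_one_eq_of_modEq_one` — (3.3): `X^{d+1} - 1 = m s + f·(X - 1)` for `f ∈ D_m` of degree `d`;
* `pow_le_abs_resultant_of_eq` — Lemma 3.1 (3.1), abstract form: `G = m T + f P`, `Res(f, G) ≠ 0 ⇒ |m|^{deg f} ≤ |Res(f, G)|`;
* `pow_le_two_pow_mul_mahlerMeasure_pow` — the bound (3.6) of the paper (auxiliary polynomial `F(x) = x - 1`):
  for `f ∈ D_m` cyclotomic-free of degree `d`, `|m|^d ≤ 2^d M(f)^{d+1}`, i.e. `log M(f) ≥ log(|m|/2)(1 - 1/(d+1))`;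
* `not_subLehmer_of_modEq_one` — for `|m| ≥ 3` and `d ≥ 1` this gives `M(f) ≥ (3/2)^{1/2} > M(L)`: no
  cyclotomic-free polynomial with all coefficients `≡ 1 (mod m)`, `|m| ≥ 3`, is sub-Lehmer.

(The sharper constant `log(√(m²+1)/2)` of [BDM07, Cor. 3.5] needs the auxiliary `(1+x)(1-x)^{m²}`; not done here.
The case `m = 2` with the optimal auxiliary is `OddCoefficientsMahlerBound`.)
-/

namespace Summit.Ventures.DiscreteObjects.Mahler

open Polynomial

/-- **[BDM07, (3.3)].** If all coefficients `f_0, …, f_d` of `f ∈ ℤ[X]` are `≡ 1 (mod m)`, then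
`X^{d+1} - 1 = m s + f · (X - 1)` for some `s ∈ ℤ[X]` with `deg s ≤ d + 1`. -/
theorem exists_X_pow_sub_one_eq_of_modEq_one {f : ℤ[X]} {m : ℤ}
    (hmod : ∀ i ≤ f.natDegree, m ∣ f.coeff i - 1) :
    ∃ s : ℤ[X], s.natDegree ≤ f.natDegree + 1 ∧
      (X ^ (f.natDegree + 1) - 1 : ℤ[X]) = C m * s + f * (X - 1) := by
  have hfX : f * (X - 1) = X * f - f := by ring
  have hcoeff : ∀ j, m ∣ (X ^ (f.natDegree + 1) - 1 - f * (X - 1) : ℤ[X]).coeff j := by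
    intro j
    rcases j with _ | i
    · have h0 : (X ^ (f.natDegree + 1) - 1 - f * (X - 1) : ℤ[X]).coeff 0 = f.coeff 0 - 1 := by
        rw [hfX, coeff_sub, coeff_sub, coeff_sub, coeff_X_pow, coeff_one_zero, coeff_X_mul_zero,
          if_neg (by omega)]
        ring
      rw [h0]
      exact hmod 0 (Nat.zero_le _)
    · have hi : (X ^ (f.natDegree + 1) - 1 - f * (X - 1) : ℤ[X]).coeff (i + 1) =
          (if i + 1 = f.natDegree + 1 then 1 else 0) - (f.coeff i - f.coeff (i + 1)) := by
        rw [hfX, coeff_sub, coeff_sub, coeff_sub, coeff_X_pow, coeff_one, coeff_X_mul,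
          if_neg (show ¬ (i + 1 = 0) by omega)]
        ring
      rw [hi]
      rcases Nat.lt_trichotomy i f.natDegree with hlt | heq | hgt
      · have hne : ¬ (i + 1 = f.natDegree + 1) := by omega
        rw [if_neg hne]
        obtain ⟨k, hk⟩ := hmod i hlt.le
        obtain ⟨l, hl⟩ := hmod (i + 1) (by omega)
        exact ⟨l - k, by linear_combination hl - hk⟩
      · rw [if_pos (by rw [heq]), coeff_eq_zero_of_natDegree_lt (n := i + 1) (by omega)]
        obtain ⟨k, hk⟩ := hmod i heq.le
        exact ⟨-k, by linear_combination -hk⟩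
      · have hne : ¬ (i + 1 = f.natDegree + 1) := by omega
        rw [if_neg hne, coeff_eq_zero_of_natDegree_lt (n := i) (by omega),
          coeff_eq_zero_of_natDegree_lt (n := i + 1) (by omega)]
        simp
  obtain ⟨s, hs⟩ := (C_dvd_iff_dvd_coeff m _).mpr hcoeff
  by_cases hm0 : m = 0
  · -- degenerate modulus: then `X^{d+1} - 1 = f (X - 1)` itself and `s` may be taken `0`
    refine ⟨0, by simp, ?_⟩
    rw [hm0, map_zero, zero_mul] at hs
    rw [mul_zero, zero_add]
    exact (sub_eq_zero.mp hs)
  refine ⟨s, ?_, ?_⟩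
  · have h2 : (C m * s).natDegree = s.natDegree := natDegree_C_mul hm0
    have hgdeg : (X ^ (f.natDegree + 1) - 1 - f * (X - 1) : ℤ[X]).natDegree ≤ f.natDegree + 1 := by
      refine (natDegree_sub_le _ _).trans (max_le ?_ ?_)
      · refine (natDegree_sub_le _ _).trans (max_le ?_ ?_)
        · rw [natDegree_X_pow]
        · simp
      · refine natDegree_mul_le.trans ?_
        rw [natDegree_X_sub_one]
    rw [← h2, ← hs]
    exact hgdeg
  · rw [← hs]
    ring

/-- **[BDM07, Lemma 3.1], abstract form, general modulus.** If `G = m T + f · P` with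
`deg P + deg f ≤ N` and `Res_{(deg f, N)}(f, G) ≠ 0`, then `|m|^{deg f} ≤ |Res(f, G)|`. -/
theorem pow_le_abs_resultant_of_eq {f G T P : ℤ[X]} {m : ℤ} {N : ℕ} (hG : G = C m * T + f * P)
    (hP : P.natDegree + f.natDegree ≤ N) (hne : f.resultant G f.natDegree N ≠ 0) :
    |m| ^ f.natDegree ≤ |f.resultant G f.natDegree N| := by
  have h1 : f.resultant G f.natDegree N = m ^ f.natDegree * f.resultant T f.natDegree N := by
    rw [hG, resultant_add_mul_right f (C m * T) P f.natDegree N hP le_rfl, resultant_C_mul_right]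
  rw [h1] at hne ⊢
  have hT : f.resultant T f.natDegree N ≠ 0 := by
    intro h
    apply hne
    rw [h, mul_zero]
  have h1T : 1 ≤ |f.resultant T f.natDegree N| := Int.one_le_abs hT
  rw [abs_mul, abs_pow]
  calc |m| ^ f.natDegree = |m| ^ f.natDegree * 1 := by ring
    _ ≤ |m| ^ f.natDegree * |f.resultant T f.natDegree N| :=
        mul_le_mul_of_nonneg_left h1T (by positivity)

/-- A polynomial with all coefficients `≡ 1 (mod m)`, `|m| ≥ 2`, is nonzero. -/
theorem ne_zero_of_modEq_one {f : ℤ[X]} {m : ℤ} (hm : 2 ≤ |m|)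
    (hmod : ∀ i ≤ f.natDegree, m ∣ f.coeff i - 1) : f ≠ 0 := by
  intro hf
  have h0 := hmod 0 (Nat.zero_le _)
  rw [hf, coeff_zero, zero_sub] at h0
  have h1 : |m| ≤ |(-1 : ℤ)| := Int.le_of_dvd (by norm_num) ((abs_dvd_abs m (-1)).mpr h0) |>.trans (le_refl _)
  norm_num at h1
  omega

/-- **[BDM07, (3.6)].**  If all coefficients `f_0, …, f_d` of `f ∈ ℤ[X]` are `≡ 1 (mod m)` (`|m| ≥ 2`)
and `f` is cyclotomic-free, then `|m|^d ≤ 2^d · M(f)^{d+1}`, i.e. `log M(f) ≥ log(|m|/2) · (1 - 1/(d+1))`. -/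
theorem pow_le_two_pow_mul_mahlerMeasure_pow {f : ℤ[X]} {m : ℤ} (hm : 2 ≤ |m|)
    (hmod : ∀ i ≤ f.natDegree, m ∣ f.coeff i - 1) (hcf : ∀ k : ℕ, 0 < k → ¬ cyclotomic k ℤ ∣ f) :
    (|m| : ℝ) ^ f.natDegree ≤ 2 ^ f.natDegree * intMahlerMeasure f ^ (f.natDegree + 1) := by
  have hf0 : f ≠ 0 := ne_zero_of_modEq_one hm hmod
  obtain ⟨s, _, hs⟩ := exists_X_pow_sub_one_eq_of_modEq_one hmod
  have hne := resultant_X_pow_sub_one_ne_zero hf0 hcf (n := f.natDegree + 1) (Nat.succ_pos _)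
  have hlow := pow_le_abs_resultant_of_eq (T := s) (P := X - 1) hs
    (by rw [natDegree_X_sub_one]; omega) hne
  -- over `ℂ`
  have hinj : Function.Injective (Int.castRingHom ℂ) := (Int.castRingHom ℂ).injective_int
  set d := f.natDegree with hd
  have hlowR : (|m| : ℝ) ^ d ≤ ‖((f.resultant (X ^ (d + 1) - 1) d (d + 1) : ℤ) : ℂ)‖ := by
    rw [Complex.norm_intCast]
    exact_mod_cast hlow
  rw [resultant_intCast_eq (f := f) (N := d + 1) (by rw [← C_1, natDegree_X_pow_sub_C]), norm_mul,
    norm_pow] at hlowR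
  have hmp := map_multiset_prod (normHom : ℂ →*₀ ℝ)
    (((f.map (Int.castRingHom ℂ)).roots.map ((X ^ (d + 1) - 1 : ℤ[X]).map (Int.castRingHom ℂ)).eval))
  rw [Multiset.map_map] at hmp
  simp only [normHom_apply, Function.comp_def] at hmp
  rw [hmp] at hlowR
  simp only [Polynomial.map_sub, Polynomial.map_pow, map_X, Polynomial.map_one, eval_sub, eval_pow,
    eval_X, eval_one] at hlowR
  -- per-root bound `|α^n - 1| ≤ 2 max(1,|α|)^n`
  have hroot : ∀ α : ℂ, ‖α ^ (d + 1) - 1‖ ≤ 2 * max 1 ‖α‖ ^ (d + 1) := by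
    intro α
    have hm1 : 1 ≤ max 1 ‖α‖ := le_max_left _ _
    calc ‖α ^ (d + 1) - 1‖ ≤ ‖α ^ (d + 1)‖ + ‖(1 : ℂ)‖ := norm_sub_le _ _
      _ = ‖α‖ ^ (d + 1) + 1 := by rw [norm_pow, norm_one]
      _ ≤ max 1 ‖α‖ ^ (d + 1) + max 1 ‖α‖ ^ (d + 1) :=
          add_le_add (pow_le_pow_left₀ (norm_nonneg _) (le_max_right _ _) _) (one_le_pow₀ hm1)
      _ = 2 * max 1 ‖α‖ ^ (d + 1) := by ring
  have hcard : Multiset.card (f.map (Int.castRingHom ℂ)).roots = d := by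
    have hsp := (IsAlgClosed.splits (f.map (Int.castRingHom ℂ))).natDegree_eq_card_roots
    rw [natDegree_map_eq_of_injective hinj] at hsp
    exact hsp.symm
  have hprod : ((f.map (Int.castRingHom ℂ)).roots.map (fun α : ℂ => ‖α ^ (d + 1) - 1‖)).prod ≤
      2 ^ d * ((f.map (Int.castRingHom ℂ)).roots.map (fun α : ℂ => max 1 ‖α‖)).prod ^ (d + 1) := by
    calc ((f.map (Int.castRingHom ℂ)).roots.map (fun α : ℂ => ‖α ^ (d + 1) - 1‖)).prod
        ≤ ((f.map (Int.castRingHom ℂ)).roots.map (fun α : ℂ => 2 * max 1 ‖α‖ ^ (d + 1))).prod :=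
          Multiset.prod_map_le_prod_map₀ _ _ (fun α _ => norm_nonneg _) (fun α _ => hroot α)
      _ = 2 ^ d * ((f.map (Int.castRingHom ℂ)).roots.map (fun α : ℂ => max 1 ‖α‖)).prod ^ (d + 1) := by
          rw [Multiset.prod_map_mul, Multiset.prod_map_pow, Multiset.map_const', Multiset.prod_replicate,
            hcard]
  have hM : intMahlerMeasure f = ‖(f.map (Int.castRingHom ℂ)).leadingCoeff‖ *
      ((f.map (Int.castRingHom ℂ)).roots.map (fun α : ℂ => max 1 ‖α‖)).prod :=
    mahlerMeasure_eq_leadingCoeff_mul_prod_roots _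
  rw [hM, mul_pow]
  calc (|m| : ℝ) ^ d ≤ ‖(f.map (Int.castRingHom ℂ)).leadingCoeff‖ ^ (d + 1) *
        ((f.map (Int.castRingHom ℂ)).roots.map (fun α : ℂ => ‖α ^ (d + 1) - 1‖)).prod := hlowR
    _ ≤ ‖(f.map (Int.castRingHom ℂ)).leadingCoeff‖ ^ (d + 1) *
        (2 ^ d * ((f.map (Int.castRingHom ℂ)).roots.map (fun α : ℂ => max 1 ‖α‖)).prod ^ (d + 1)) :=
          mul_le_mul_of_nonneg_left hprod (by positivity)
    _ = 2 ^ d * (‖(f.map (Int.castRingHom ℂ)).leadingCoeff‖ ^ (d + 1) *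
        ((f.map (Int.castRingHom ℂ)).roots.map (fun α : ℂ => max 1 ‖α‖)).prod ^ (d + 1)) := by ring

/-- `2^{e+1} (6/5)^{e+2} ≤ 3^{e+1}` (elementary, by induction). -/
theorem two_pow_mul_six_fifths_pow_le (e : ℕ) :
    (2 : ℝ) ^ (e + 1) * (6 / 5 : ℝ) ^ (e + 1 + 1) ≤ 3 ^ (e + 1) := by
  induction e with
  | zero => norm_num
  | succ e ih =>
    have e1 : (2 : ℝ) ^ (e + 1 + 1) * (6 / 5 : ℝ) ^ (e + 1 + 1 + 1) =
        (12 / 5) * ((2 : ℝ) ^ (e + 1) * (6 / 5 : ℝ) ^ (e + 1 + 1)) := by ring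
    rw [e1, pow_succ (3 : ℝ) (e + 1)]
    nlinarith [ih, pow_pos (by norm_num : (0 : ℝ) < 3) (e + 1)]

/-- **No cyclotomic-free polynomial with all coefficients `≡ 1 (mod m)`, `|m| ≥ 3`, is sub-Lehmer**:
for `d ≥ 1`, `M(f)^{d+1} ≥ (3/2)^d`, so `M(f) ≥ (3/2)^{1/2} > 1.22 > M(L)`; for `d = 0`, `M(f) = |f_0|` is
an integer. -/
theorem not_subLehmer_of_modEq_one {f : ℤ[X]} {m : ℤ} (hm : 3 ≤ |m|)
    (hmod : ∀ i ≤ f.natDegree, m ∣ f.coeff i - 1) (hcf : ∀ k : ℕ, 0 < k → ¬ cyclotomic k ℤ ∣ f) :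
    ¬ SubLehmer f := by
  intro hsub
  have hL := lehmer_measure_upper_bound
  have hf0 : f ≠ 0 := ne_zero_of_modEq_one (by omega) hmod
  obtain ⟨h1, h2⟩ := hsub
  have hM1 : 1 ≤ intMahlerMeasure f := one_le_intMahlerMeasure hf0
  rcases Nat.eq_zero_or_pos f.natDegree with hd0 | hdpos
  · have hC := eq_C_of_natDegree_eq_zero hd0
    have hM : intMahlerMeasure f = |(f.coeff 0 : ℝ)| := by
      unfold intMahlerMeasure
      rw [hC, map_C, mahlerMeasure_const, eq_intCast, Complex.norm_intCast, coeff_C_zero]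
    rw [hM] at h1 h2
    have h3 : (2 : ℝ) ≤ |(f.coeff 0 : ℝ)| := by
      have h1' : (1 : ℤ) < |f.coeff 0| := by exact_mod_cast h1
      have : (2 : ℤ) ≤ |f.coeff 0| := h1'
      exact_mod_cast this
    linarith
  · have h := pow_le_two_pow_mul_mahlerMeasure_pow (by omega) hmod hcf
    set d := f.natDegree with hd
    -- `M < 6/5` gives `2^d M^{d+1} < 2^d (6/5)^{d+1} ≤ 3^d` for `d ≥ 1`; contradiction with `3^d ≤ |m|^d`
    have hlt : intMahlerMeasure f < 6 / 5 := by linarith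
    have hM0 : 0 ≤ intMahlerMeasure f := by linarith
    have h3 : (3 : ℝ) ^ d ≤ (|m| : ℝ) ^ d := by
      apply pow_le_pow_left₀ (by norm_num)
      exact_mod_cast hm
    have h4 : intMahlerMeasure f ^ (d + 1) < (6 / 5 : ℝ) ^ (d + 1) := pow_lt_pow_left₀ hlt hM0 (by omega)
    have h5 : (2 : ℝ) ^ d * (6 / 5 : ℝ) ^ (d + 1) ≤ 3 ^ d := by
      obtain ⟨e, he⟩ : ∃ e, d = e + 1 := ⟨d - 1, by omega⟩
      rw [he]
      exact two_pow_mul_six_fifths_pow_le e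
    have h6 : (2 : ℝ) ^ d * intMahlerMeasure f ^ (d + 1) < 2 ^ d * (6 / 5 : ℝ) ^ (d + 1) :=
      mul_lt_mul_of_pos_left h4 (by positivity)
    linarith

end Summit.Ventures.DiscreteObjects.Mahler
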